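import Summits.Parity.GeneralizedHardyLittlewood.Theorems.LiouvilleShiftedTablesSieveToMAvgCaseII

/-!
# Sieve glue for `SieveToMAvg`, part 9c: uniform per-tuple bounds — the Type-I₂ cases

Support file for item stmt-Parity-14274 (route `LiouvilleShiftedTables`).  A relevant tuple with a
designated big smooth slot `p` and small remaining slots (case (i)), or with two big smooth slots
`p, σ` (`P_σ ≤ 2^j √(2x)`, `P_p > (2x)^{b'}`) and small remaining slots (case (ii)), satisfies
`TT(prodB κ) ≤ BI2` (part 8b plus the uniform divisor power sum bounds; the supports multiply back to
`2^{2j} ∏ P_i ≤ 2^{2j} · 2x`, which is what keeps the thin-set error `≪ Δ x · polylog`).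
-/

namespace Summit.Parity.GeneralizedHardyLittlewood.Theorems.SieveToMAvg

open Finset Real
open scoped ArithmeticFunction.zeta ArithmeticFunction.sigma
open Literature.NumberTheory.Sieve.BFI

section CaseI2

variable {x : ℝ} {U j t : ℕ} {h : ℕ} {X Δ ρ' A C₂ Cτ a' b' : ℝ} {e : ℕ}

/-- The common algebra of both cases: from the raw bound of part 8b with data `(R, s₂, n₁, n₂)`
satisfying `s₂ Dτ(4j,R) ≤ 2Cτ ℓ^e 2^{2j}(2x)^{1−b'}`, `Dτ(2j,R) s₂ (n₁+n₂) ≤ 4 Cτ ℓ^e 2^{2j} x`,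
`Dτ(2j,R) s₂ ≤ Cτ ℓ^e 2^{2j} (2x)^{1−b'}`, `(1+Δ)²−1 ≤ 3Δ`, to `BI2`. [folklore] -/
theorem raw_le_BI2 (hx : 1 / 2 ≤ x) (hΔ : 0 ≤ Δ) (hΔ1 : Δ ≤ 1) {Kf Q : ℕ}
    {s₂ n₁ n₂ D4 D2 : ℝ} (hs₂ : 0 ≤ s₂) (hn : 0 ≤ n₁ + n₂) (hD2 : 0 ≤ D2)
    (h1 : s₂ * D4 ≤ 2 * Cτ * ell2 j x ^ e * 2 ^ (2 * j) * (2 * x) ^ (1 - b'))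
    (h2 : D2 * s₂ * (n₁ + n₂) ≤ 4 * (Cτ * ell2 j x ^ e * 2 ^ (2 * j) * x))
    (h3 : D2 * s₂ ≤ Cτ * ell2 j x ^ e * 2 ^ (2 * j) * (2 * x) ^ (1 - b')) :
    4 * Kf * Real.sqrt Kf *
        Real.sqrt (2 * x * Hsum Q * Hsum (2 * x) * Dtau' (4 * j) (2 * x) + s₂ * Q * D4) *
          Real.sqrt (C₂ * X / Real.log X ^ A) +
      D2 * s₂ * ((((1 + Δ) ^ 2 - 1) * (n₁ + n₂) + 2) * Hsum Q + 2 * Q) ≤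
    BI2 j x X Δ A C₂ Cτ b' e Kf Q := by
  unfold BI2
  have hHQ := Hsum_nonneg (Q : ℝ)
  have hℓ := one_le_ell2 j hx
  refine add_le_add ?_ ?_
  · have hin : s₂ * Q * D4 ≤ Q * (2 * Cτ * ell2 j x ^ e * 2 ^ (2 * j) * (2 * x) ^ (1 - b')) := by
      calc s₂ * Q * D4 = Q * (s₂ * D4) := by ring
        _ ≤ _ := mul_le_mul_of_nonneg_left h1 (Nat.cast_nonneg Q)
    have hD' := Dtau'_nonneg (4 * j) (2 * x)
    have hH2 := Hsum_nonneg (2 * x)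
    gcongr
  · have hΔ3 : (1 + Δ) ^ 2 - 1 ≤ 3 * Δ := by nlinarith
    have hD2s : 0 ≤ D2 * s₂ := mul_nonneg hD2 hs₂
    calc D2 * s₂ * ((((1 + Δ) ^ 2 - 1) * (n₁ + n₂) + 2) * Hsum Q + 2 * Q)
        = ((1 + Δ) ^ 2 - 1) * Hsum Q * (D2 * s₂ * (n₁ + n₂)) + D2 * s₂ * (2 * Hsum Q + 2 * Q) := by ring
      _ ≤ (3 * Δ) * Hsum Q * (4 * (Cτ * ell2 j x ^ e * 2 ^ (2 * j) * x)) +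
            (Cτ * ell2 j x ^ e * 2 ^ (2 * j) * (2 * x) ^ (1 - b')) * (2 * Hsum Q + 2 * Q) := by
          have hDn : 0 ≤ D2 * s₂ * (n₁ + n₂) := mul_nonneg hD2s hn
          have hD0 : 0 ≤ (1 + Δ) ^ 2 - 1 := by nlinarith
          gcongr
      _ = 12 * Δ * Hsum Q * Cτ * ell2 j x ^ e * 2 ^ (2 * j) * x +
            Cτ * ell2 j x ^ e * 2 ^ (2 * j) * (2 * x) ^ (1 - b') * (2 * Hsum Q + 2 * Q) := by ring

/-- **Case (i): one big smooth slot.** [folklore] -/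
theorem TT_prodB_caseI2_one (hyp : HypI2 X (-(h : ℤ)) h ρ' A C₂) (hX : 1 ≤ X) (hx : 1 ≤ x) (hxX : 2 * x ≤ X)
    (hΔ : 0 < Δ) (hΔ1 : Δ ≤ 1) {Kf : ℕ} (hKf : 2 * x < (1 + Δ) ^ Kf) {Q : ℕ} (hQ : Q ≤ ⌊X ^ ρ'⌋₊)
    (hCτ : 0 ≤ Cτ) (hD4 : ∀ Y : ℝ, 1 ≤ Y → Dtau (4 * j) Y ≤ Cτ * Y * (1 + Real.log Y) ^ e)
    (hD2 : ∀ Y : ℝ, 1 ≤ Y → Dtau (2 * j) Y ≤ Cτ * Y * (1 + Real.log Y) ^ e)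
    (hab : a' ≤ 1 - b') (hC9 : 2 ^ (2 * j) * (2 * x) ^ a' ≤ X ^ ρ') (hC10 : 2 ^ (2 * j) * (2 * x) ^ a' ≤ 2 * x)
    (κ : Fin (2 * j) → ℕ) (hP : ∀ i, 1 / 2 ≤ P x (κ i)) (hprod : ∏ i, P x (κ i) < 2 * x)
    {p : Fin (2 * j)} (hp : j ≤ (p : ℕ))
    (hsmall : ∏ i ∈ Finset.univ.erase p, P x (κ i) < (2 * x) ^ a') :
    TT (lamW h) h Q x (fun n => prodB x U j t κ n) ≤ BI2 j x X Δ A C₂ Cτ b' e Kf Q := by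
  have hx0 : 0 < x := by linarith
  have h2x : 1 ≤ 2 * x := by linarith
  set T := Finset.univ.erase p with hT
  have hTne : T.Nonempty := by
    have hj : 1 ≤ j := by
      rcases Nat.eq_zero_or_pos j with h0 | h0
      · exact absurd p.isLt (by omega)
      · exact h0
    have : 2 ≤ (Finset.univ : Finset (Fin (2 * j))).card := by rw [Finset.card_univ, Fintype.card_fin]; omega
    rw [hT, ← Finset.card_pos, Finset.card_erase_of_mem (Finset.mem_univ p)]; omega
  have hcardT : T.card = 2 * j - 1 := by
    rw [hT, Finset.card_erase_of_mem (Finset.mem_univ p), Finset.card_univ, Fintype.card_fin]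
  set R := 2 ^ T.card * ∏ i ∈ T, P x (κ i) with hR
  have hR1 : 1 ≤ R := one_le_two_pow_mul_prod κ hP T
  have hpT : 0 < ∏ i ∈ T, P x (κ i) := Finset.prod_pos fun i _ => P_pos hx0 (κ i)
  have hRle : R ≤ 2 ^ (2 * j) * (2 * x) ^ a' := by
    have h1 : (2 : ℝ) ^ T.card ≤ 2 ^ (2 * j) := pow_le_pow_right₀ (by norm_num) (by omega)
    exact mul_le_mul h1 hsmall.le hpT.le (by positivity)
  have hRX : R ≤ X ^ ρ' := hRle.trans hC9
  have hRx : R ≤ 2 * x := hRle.trans hC10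
  have hends := indAF_ends_ok (j := j) (t := t) hx0 p (κ p)
  have hdecomp := prodB_eq_triple_one (U := U) (t := t) hx0 κ hp
  have hsR : (1 : ℝ) * R ≤ X ^ (1 / 2 + ρ') := by
    rw [one_mul]
    refine hRX.trans (Real.rpow_le_rpow_of_exponent_le hX (by linarith))
  have hraw := TT_prodB_le_I2 hyp hx0 hxX hΔ hKf hQ κ hTne hdecomp hR1 hRX hRx one_pos h2x hsR hends.1 hends.2
  refine hraw.trans (raw_le_BI2 (by linarith) hΔ.le hΔ1 zero_le_one ?_ (Dtau_nonneg _ _) ?_ ?_ ?_)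
  · linarith [hends.1, hends.2, P_pos hx0 (κ p)]
  · -- `1 · Dτ(4j, R) ≤ 2 Cτ ℓ^e 2^{2j} (2x)^{1−b'}`
    have hZ : R ≤ 2 ^ (2 * j) * (2 * x) := hRx.trans (le_mul_of_one_le_left (by linarith) (one_le_pow₀ (by norm_num)))
    have hDR := (hD4 R hR1).trans (majorant_mono hCτ hR1 hZ e)
    have hab' : (2 * x) ^ a' ≤ (2 * x) ^ (1 - b') := Real.rpow_le_rpow_of_exponent_le h2x hab
    have hℓ := one_le_ell2 j (by linarith : 1 / 2 ≤ x)
    rw [one_mul]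
    calc Dtau (4 * j) R ≤ Cτ * R * ell2 j x ^ e := hDR
      _ ≤ Cτ * (2 ^ (2 * j) * (2 * x) ^ (1 - b')) * ell2 j x ^ e := by
          have : R ≤ 2 ^ (2 * j) * (2 * x) ^ (1 - b') := hRle.trans (mul_le_mul_of_nonneg_left hab' (by positivity))
          gcongr
      _ ≤ 2 * Cτ * ell2 j x ^ e * 2 ^ (2 * j) * (2 * x) ^ (1 - b') := by
          have h0 : 0 ≤ Cτ * (2 ^ (2 * j) * (2 * x) ^ (1 - b')) * ell2 j x ^ e := by
            have := Real.rpow_nonneg (by linarith : (0 : ℝ) ≤ 2 * x) (1 - b')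
            positivity
          nlinarith
  · -- `Dτ(2j,R) · 1 · (n₁+n₂) ≤ 4 Cτ ℓ^e 2^{2j} x`
    have hZ : R ≤ 2 ^ (2 * j) * (2 * x) := hRx.trans (le_mul_of_one_le_left (by linarith) (one_le_pow₀ (by norm_num)))
    have hDR := (hD2 R hR1).trans (majorant_mono hCτ hR1 hZ e)
    have hn : (min (max (P x (κ p)) (tCut j t p)) (2 * P x (κ p))) + 2 * P x (κ p) ≤ 4 * P x (κ p) := by
      linarith [hends.2]
    have hRP : R * P x (κ p) ≤ 2 ^ (2 * j) * x := by
      have hprod' : (∏ i ∈ T, P x (κ i)) * P x (κ p) = ∏ i, P x (κ i) := by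
        rw [hT]; exact Finset.prod_erase_mul (Finset.univ) (fun i => P x (κ i)) (Finset.mem_univ p)
      calc R * P x (κ p) = 2 ^ T.card * ((∏ i ∈ T, P x (κ i)) * P x (κ p)) := by rw [hR]; ring
        _ = 2 ^ (2 * j - 1) * ∏ i, P x (κ i) := by rw [hprod', hcardT]
        _ ≤ 2 ^ (2 * j - 1) * (2 * x) := mul_le_mul_of_nonneg_left hprod.le (by positivity)
        _ = 2 ^ (2 * j - 1 + 1) * x := by rw [pow_succ]; ring
        _ = 2 ^ (2 * j) * x := by
            have hj : 1 ≤ 2 * j := by have := p.isLt; omega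
            rw [Nat.sub_add_cancel hj]
    have hℓ := one_le_ell2 j (by linarith : 1 / 2 ≤ x)
    calc Dtau (2 * j) R * 1 * ((min (max (P x (κ p)) (tCut j t p)) (2 * P x (κ p))) + 2 * P x (κ p))
        ≤ (Cτ * R * ell2 j x ^ e) * (4 * P x (κ p)) := by
          rw [mul_one]
          exact mul_le_mul hDR hn (by linarith [hends.1, hends.2, P_pos hx0 (κ p)]) (by positivity)
      _ = 4 * (Cτ * ell2 j x ^ e * (R * P x (κ p))) := by ring
      _ ≤ 4 * (Cτ * ell2 j x ^ e * (2 ^ (2 * j) * x)) := by gcongr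
      _ = 4 * (Cτ * ell2 j x ^ e * 2 ^ (2 * j) * x) := by ring
  · -- `Dτ(2j,R) · 1 ≤ Cτ ℓ^e 2^{2j} (2x)^{1−b'}`
    have hZ : R ≤ 2 ^ (2 * j) * (2 * x) := hRx.trans (le_mul_of_one_le_left (by linarith) (one_le_pow₀ (by norm_num)))
    have hDR := (hD2 R hR1).trans (majorant_mono hCτ hR1 hZ e)
    have hab' : (2 * x) ^ a' ≤ (2 * x) ^ (1 - b') := Real.rpow_le_rpow_of_exponent_le h2x hab
    have hℓ := one_le_ell2 j (by linarith : 1 / 2 ≤ x)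
    rw [mul_one]
    calc Dtau (2 * j) R ≤ Cτ * R * ell2 j x ^ e := hDR
      _ ≤ Cτ * (2 ^ (2 * j) * (2 * x) ^ (1 - b')) * ell2 j x ^ e := by
          have : R ≤ 2 ^ (2 * j) * (2 * x) ^ (1 - b') := hRle.trans (mul_le_mul_of_nonneg_left hab' (by positivity))
          gcongr
      _ = Cτ * ell2 j x ^ e * 2 ^ (2 * j) * (2 * x) ^ (1 - b') := by ring

/-- **Case (ii): two big smooth slots.** [folklore] -/
theorem TT_prodB_caseI2_two (hyp : HypI2 X (-(h : ℤ)) h ρ' A C₂) (hx : 1 ≤ x) (hxX : 2 * x ≤ X)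
    (hΔ : 0 < Δ) (hΔ1 : Δ ≤ 1) {Kf : ℕ} (hKf : 2 * x < (1 + Δ) ^ Kf) {Q : ℕ} (hQ : Q ≤ ⌊X ^ ρ'⌋₊)
    (hCτ : 0 ≤ Cτ) (hD4 : ∀ Y : ℝ, 1 ≤ Y → Dtau (4 * j) Y ≤ Cτ * Y * (1 + Real.log Y) ^ e)
    (hD2 : ∀ Y : ℝ, 1 ≤ Y → Dtau (2 * j) Y ≤ Cτ * Y * (1 + Real.log Y) ^ e)
    (hC9 : 2 ^ (2 * j) * (2 * x) ^ a' ≤ X ^ ρ') (hC10 : 2 ^ (2 * j) * (2 * x) ^ a' ≤ 2 * x)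
    (hC11 : 2 ^ (3 * j + 1) * (2 * x) ^ (1 / 2 + a') ≤ X ^ (1 / 2 + ρ'))
    (κ : Fin (2 * j) → ℕ) (hP : ∀ i, 1 / 2 ≤ P x (κ i)) (hprod : ∏ i, P x (κ i) < 2 * x)
    {p σ' : Fin (2 * j)} (hp : j ≤ (p : ℕ)) (hσ : j ≤ (σ' : ℕ)) (hne : σ' ≠ p)
    (hPσ : P x (κ σ') ≤ 2 ^ j * (2 * x) ^ ((1 : ℝ) / 2)) (hPp : (2 * x) ^ b' < P x (κ p))
    (hsmall : ∏ i ∈ (Finset.univ.erase p).erase σ', P x (κ i) < (2 * x) ^ a') :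
    TT (lamW h) h Q x (fun n => prodB x U j t κ n) ≤ BI2 j x X Δ A C₂ Cτ b' e Kf Q := by
  have hx0 : 0 < x := by linarith
  have h2x : 1 ≤ 2 * x := by linarith
  have h2x0 : 0 < 2 * x := by linarith
  set T := (Finset.univ.erase p).erase σ' with hT
  have hσmem : σ' ∈ Finset.univ.erase p := Finset.mem_erase.2 ⟨hne, Finset.mem_univ _⟩
  have hcardT : T.card = 2 * j - 2 := by
    rw [hT, Finset.card_erase_of_mem hσmem, Finset.card_erase_of_mem (Finset.mem_univ p), Finset.card_univ,
      Fintype.card_fin]; omega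
  have hj2 : 2 ≤ j := by
    -- two distinct slots in `[j, 2j)`
    have h1 := p.isLt; have h2 := σ'.isLt
    by_contra hlt
    have : (p : ℕ) = σ' := by omega
    exact hne (Fin.ext this.symm)
  have hTne : T.Nonempty := by rw [← Finset.card_pos, hcardT]; omega
  set R := 2 ^ T.card * ∏ i ∈ T, P x (κ i) with hR
  have hR1 : 1 ≤ R := one_le_two_pow_mul_prod κ hP T
  have hpT : 0 < ∏ i ∈ T, P x (κ i) := Finset.prod_pos fun i _ => P_pos hx0 (κ i)
  have hRle : R ≤ 2 ^ (2 * j) * (2 * x) ^ a' := by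
    have h1 : (2 : ℝ) ^ T.card ≤ 2 ^ (2 * j) := pow_le_pow_right₀ (by norm_num) (by omega)
    exact mul_le_mul h1 hsmall.le hpT.le (by positivity)
  have hRX : R ≤ X ^ ρ' := hRle.trans hC9
  have hRx : R ≤ 2 * x := hRle.trans hC10
  have hPσpos := P_pos hx0 (κ σ')
  have hPppos := P_pos hx0 (κ p)
  have hendsσ := indAF_ends_ok (j := j) (t := t) hx0 σ' (κ σ')
  have hendsp := indAF_ends_ok (j := j) (t := t) hx0 p (κ p)
  have hdecomp := prodB_eq_triple_two (U := U) (t := t) hx0 κ hp hσ hne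
  have hs₂ : 0 < 2 * P x (κ σ') := by linarith
  have hs₂x : 2 * P x (κ σ') ≤ 2 * x := by linarith [P_le hx0.le (κ σ')]
  have hsR : 2 * P x (κ σ') * R ≤ X ^ (1 / 2 + ρ') := by
    calc 2 * P x (κ σ') * R ≤ 2 * (2 ^ j * (2 * x) ^ ((1 : ℝ) / 2)) * (2 ^ (2 * j) * (2 * x) ^ a') :=
          mul_le_mul (by linarith) hRle (by linarith) (by positivity)
      _ = 2 ^ (3 * j + 1) * (2 * x) ^ (1 / 2 + a') := by
          rw [Real.rpow_add h2x0, show 3 * j + 1 = j + 2 * j + 1 by ring, pow_add, pow_add, pow_one]; ring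
      _ ≤ X ^ (1 / 2 + ρ') := hC11
  have hraw := TT_prodB_le_I2 hyp hx0 hxX hΔ hKf hQ κ hTne hdecomp hR1 hRX hRx hs₂ hs₂x hsR hendsp.1 hendsp.2
  -- products of the boxes
  have hprodT : (∏ i ∈ T, P x (κ i)) * P x (κ σ') * P x (κ p) = ∏ i, P x (κ i) := by
    rw [hT, Finset.prod_erase_mul _ (fun i => P x (κ i)) hσmem,
      Finset.prod_erase_mul (Finset.univ) (fun i => P x (κ i)) (Finset.mem_univ p)]
  have hRPσ : R * P x (κ σ') ≤ 2 ^ (2 * j - 2) * (2 * x) ^ (1 - b') := by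
    -- `∏_{i ≠ p} P_i = ∏ P / P_p < 2x / (2x)^{b'}`
    have h1 : (∏ i ∈ T, P x (κ i)) * P x (κ σ') * P x (κ p) < (2 * x) ^ (1 - b') * P x (κ p) := by
      rw [hprodT, Real.rpow_sub h2x0, Real.rpow_one]
      calc ∏ i, P x (κ i) < 2 * x := hprod
        _ = 2 * x / (2 * x) ^ b' * (2 * x) ^ b' := by field_simp
        _ ≤ 2 * x / (2 * x) ^ b' * P x (κ p) := mul_le_mul_of_nonneg_left hPp.le (by positivity)
    have h2 : (∏ i ∈ T, P x (κ i)) * P x (κ σ') ≤ (2 * x) ^ (1 - b') := le_of_lt (lt_of_mul_lt_mul_right h1 hPppos.le)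
    calc R * P x (κ σ') = 2 ^ T.card * ((∏ i ∈ T, P x (κ i)) * P x (κ σ')) := by rw [hR]; ring
      _ ≤ 2 ^ (2 * j - 2) * (2 * x) ^ (1 - b') := by rw [hcardT]; exact mul_le_mul_of_nonneg_left h2 (by positivity)
  have hRPσPp : R * P x (κ σ') * P x (κ p) ≤ 2 ^ (2 * j - 2) * (2 * x) := by
    calc R * P x (κ σ') * P x (κ p) = 2 ^ T.card * ((∏ i ∈ T, P x (κ i)) * P x (κ σ') * P x (κ p)) := by
          rw [hR]; ring
      _ ≤ 2 ^ (2 * j - 2) * (2 * x) := by rw [hprodT, hcardT]; exact mul_le_mul_of_nonneg_left hprod.le (by positivity)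
  have hZ : R ≤ 2 ^ (2 * j) * (2 * x) := hRx.trans (le_mul_of_one_le_left (by linarith) (one_le_pow₀ (by norm_num)))
  have hDR4 := (hD4 R hR1).trans (majorant_mono hCτ hR1 hZ e)
  have hDR2 := (hD2 R hR1).trans (majorant_mono hCτ hR1 hZ e)
  have hℓ := one_le_ell2 j (by linarith : 1 / 2 ≤ x)
  have hpow2 : (2 : ℝ) ^ (2 * j - 2) ≤ 2 ^ (2 * j) := pow_le_pow_right₀ (by norm_num) (by omega)
  have hpow1 : (2 : ℝ) ^ (2 * j - 2) * 2 ≤ 2 ^ (2 * j) := by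
    calc (2 : ℝ) ^ (2 * j - 2) * 2 = 2 ^ (2 * j - 2 + 1) := by rw [pow_succ]
      _ ≤ 2 ^ (2 * j) := pow_le_pow_right₀ (by norm_num) (by omega)
  have hrp : 0 ≤ (2 * x) ^ (1 - b') := Real.rpow_nonneg h2x0.le _
  have hℓ0 : 0 ≤ ell2 j x ^ e := pow_nonneg (by linarith) e
  have hCℓ : 0 ≤ Cτ * ell2 j x ^ e := mul_nonneg hCτ hℓ0
  have hC2ℓ : 0 ≤ 2 * Cτ * ell2 j x ^ e := by rw [mul_assoc]; exact mul_nonneg (by norm_num) hCℓ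
  have h8 : 0 ≤ 8 * (Cτ * ell2 j x ^ e) := mul_nonneg (by norm_num) hCℓ
  refine hraw.trans (raw_le_BI2 (by linarith) hΔ.le hΔ1 hs₂.le ?_ (Dtau_nonneg _ _) ?_ ?_ ?_)
  · linarith [hendsp.1, hendsp.2]
  · -- `2P_σ Dτ(4j,R) ≤ 2 Cτ ℓ^e 2^{2j} (2x)^{1−b'}`
    calc 2 * P x (κ σ') * Dtau (4 * j) R ≤ 2 * P x (κ σ') * (Cτ * R * ell2 j x ^ e) :=
          mul_le_mul_of_nonneg_left hDR4 (by linarith)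
      _ = 2 * Cτ * ell2 j x ^ e * (R * P x (κ σ')) := by ring
      _ ≤ 2 * Cτ * ell2 j x ^ e * (2 ^ (2 * j - 2) * (2 * x) ^ (1 - b')) := mul_le_mul_of_nonneg_left hRPσ hC2ℓ
      _ ≤ 2 * Cτ * ell2 j x ^ e * (2 ^ (2 * j) * (2 * x) ^ (1 - b')) :=
          mul_le_mul_of_nonneg_left (mul_le_mul_of_nonneg_right hpow2 hrp) hC2ℓ
      _ = 2 * Cτ * ell2 j x ^ e * 2 ^ (2 * j) * (2 * x) ^ (1 - b') := by ring
  · -- `Dτ(2j,R) · 2P_σ · (n₁+n₂) ≤ 4 Cτ ℓ^e 2^{2j} x`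
    have hn : (min (max (P x (κ p)) (tCut j t p)) (2 * P x (κ p))) + 2 * P x (κ p) ≤ 4 * P x (κ p) := by
      linarith [hendsp.2]
    have hn0 : 0 ≤ (min (max (P x (κ p)) (tCut j t p)) (2 * P x (κ p))) + 2 * P x (κ p) := by
      linarith [hendsp.1, hendsp.2]
    calc Dtau (2 * j) R * (2 * P x (κ σ')) * ((min (max (P x (κ p)) (tCut j t p)) (2 * P x (κ p))) + 2 * P x (κ p))
        ≤ (Cτ * R * ell2 j x ^ e) * (2 * P x (κ σ')) * (4 * P x (κ p)) :=
          mul_le_mul (mul_le_mul_of_nonneg_right hDR2 (by linarith)) hn hn0 (by positivity)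
      _ = 8 * (Cτ * ell2 j x ^ e) * (R * P x (κ σ') * P x (κ p)) := by ring
      _ ≤ 8 * (Cτ * ell2 j x ^ e) * (2 ^ (2 * j - 2) * (2 * x)) := mul_le_mul_of_nonneg_left hRPσPp h8
      _ = 4 * (Cτ * ell2 j x ^ e * (2 ^ (2 * j - 2) * 2 * 2) * x) := by ring
      _ ≤ 4 * (Cτ * ell2 j x ^ e * 2 ^ (2 * j) * x) := by
          have h22 : (2 : ℝ) ^ (2 * j - 2) * 2 * 2 ≤ 2 ^ (2 * j) := by
            rw [show (2 : ℝ) ^ (2 * j - 2) * 2 * 2 = 2 ^ (2 * j - 2 + 2) by rw [pow_add]; ring,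
              show 2 * j - 2 + 2 = 2 * j by omega]
          have hCℓ : 0 ≤ Cτ * ell2 j x ^ e := mul_nonneg hCτ (pow_nonneg (by linarith) e)
          exact mul_le_mul_of_nonneg_left (mul_le_mul_of_nonneg_right
            (mul_le_mul_of_nonneg_left h22 hCℓ) hx0.le) (by norm_num)
  · -- `Dτ(2j,R) · 2P_σ ≤ Cτ ℓ^e 2^{2j} (2x)^{1−b'}`
    calc Dtau (2 * j) R * (2 * P x (κ σ')) ≤ (Cτ * R * ell2 j x ^ e) * (2 * P x (κ σ')) :=
          mul_le_mul_of_nonneg_right hDR2 (by linarith)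
      _ = Cτ * ell2 j x ^ e * (R * P x (κ σ')) * 2 := by ring
      _ ≤ Cτ * ell2 j x ^ e * (2 ^ (2 * j - 2) * (2 * x) ^ (1 - b')) * 2 :=
          mul_le_mul_of_nonneg_right (mul_le_mul_of_nonneg_left hRPσ hCℓ) (by norm_num)
      _ = Cτ * ell2 j x ^ e * (2 ^ (2 * j - 2) * 2) * (2 * x) ^ (1 - b') := by ring
      _ ≤ Cτ * ell2 j x ^ e * 2 ^ (2 * j) * (2 * x) ^ (1 - b') :=
          mul_le_mul_of_nonneg_right (mul_le_mul_of_nonneg_left hpow1 hCℓ) hrp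

end CaseI2

end Summit.Parity.GeneralizedHardyLittlewood.Theorems.SieveToMAvg
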